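import Summits.QuantumFields.BalabanUV.Beta.EriceRemainderEnclosureHistoryRenewalBlocks

/-!
# EriceRemainderEnclosureHistoryRenewalExtremal — (E34a) IS THE STRETCHED SHAPE SHARP?  At the level of the ROW SYSTEM — the exact
# output of NE4-as-typed's row split ((E33a) `disc_row_split` ∕ `disc_row_full`) plus the pin and the AF weight sum — YES: the system
# has explicit solutions decaying no faster than `exp(−B·√j·log j)`, so NO GEOMETRIC matching rate (node U2's `InjectedRate C 0 θ` shape)
# can follow from it; (E33g)'s K-uniform `L·ρ^⌊√j⌋` is optimal in the exponent `½` up to the logarithm (abstract real sequences)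

Cell `pub-balaban`, β-function sub-cell, BINDER row D4 «RemainderConst leaves for Bałaban's split» (`HOME/BINDER-OWNERS.md`; owner
lineage `b2b-balaban-beta-an4`; this file by co-owner #2 lineage `b2b-balaban-beta-d4-p2`, generation 36), β-FLOW TEAM duty (1),
FREEZE (0) honoured (def-free; no leaf, no hypothesis shape, no β: ABSTRACT real sequences only).  Sequel of (E33b)
`EriceRemainderEnclosureHistoryRenewalBlocks` ∕ (E33g) `EriceRemainderEnclosureHistoryRenewalStretched` on the question left OPEN by
station (E33) and by the OWNER's cross-read C-an4g85-16 («sharpness honestly OPEN»): can the row total weight of the history modulus +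
NE4 as typed + asymptotic freedom give node U2's GEOMETRIC two-run matching rate `θ^j` WITHOUT `FadingMemory`?

HONEST FRAMING.  [folklore] real analysis; nothing of Bałaban's [I] is quoted, typed or asserted here; row D4 class UNCHANGED
(critical-path width 0; instance 0∕1; D4 DISCHARGE NO DATE); NOT B12 Thm 2, NOT BetaPertH, NOT continuum, NOT Clay.  HONEST DEPENDENCY:
continuum YM on T⁴ ⇐ BetaPertH ∧ nine spine estimates (0/9 proved); BetaPertH ⇐ (D1) ∧ (D4) ∧ CAP+tail; G-an2-4 gates asym, D1 and NE2/3/4.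
SCOPE (binding): this is a statement about the METHOD — the inequality system through which (E33c) `disc_le_stretched`, (E33f)
`disc_le_log` and (E33g) `disc_le_sqrt_uniform` are derived — NOT about admissible β-families: whether an actual history family
`β : FlowStep.HBeta` in (E33)'s binder class realizes the extremal solutions below (a β-level lower bound on two-run discrepancies) stays
OPEN; what is settled is that a geometric rate, if true at the β level, needs an input the row split does not carry.

THE ROW SYSTEM (letter for letter the conclusions of (E33a) `disc_row_split`, `disc_row_full`, node U2's `disc_pin` ∕ `disc_nonneg`, with
`δ = disc gA gB`, `w_l = (g^A_l)²g^B_{l+1}`, `m = A³M`): `δ ≥ 0`, `δ_K = 0`, `w ≥ 0`, `Σ_{l≤K} w_l ≤ U`, and for every row `l < K`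
 (split, every window `s`)  `δ_l ≤ δ_{l+1} + cθ^l + 2(cθ^s∕(1−θ)) + m·w_l·B′` for every bound `B′` of `δ` on `[l − s, l]`;
 (full window)              `δ_l ≤ δ_{l+1} + cθ^l + m·w_l·B′` for every bound `B′` of `δ` on `[0, l]`.
THE EXTREMAL PROFILE (§1 `blockProfile_rows`).  Blocks of `L` scales; on block `t ≤ T` the constant value `V_t = cθ^{2L}∕R^t`, then `0`:
`δ_l = V_{⌊l∕L⌋}`.  Each block end drops by `≤ V_t`; a window that does not reach the previous block is shorter than `2L`, so its deletion
term `2cθ^s∕(1−θ) ≥ cθ^{2L} ≥ V_t` pays; a window that reaches it sees `V_{t−1} = R·V_t`, and the feedback pays as soon as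
`R·m·w_l ≥ 1`; block `0` is paid by the source `cθ^l`.  With the INFRARED-CONCENTRATED, polynomially decaying weights
`w_l = U∕((K−l+1)(K−l+2))` (`Σ ≤ U`, non-decreasing towards the pin, dominated by the asymptotic-freedom profile `(K−l+1)^{−3∕2}`; §2) and
`K = L² + L`, `T = L`, the condition is `R ≥ 4L⁴∕(mU)` and the profile has `δ_{L²} = cθ^{2L}∕R^L = exp(−Θ(L log L)) = exp(−Θ(√j log j))`
at `j = L²` (§3 `rowSystem_instance`, §4 `rowSystem_envelope`).  CONSEQUENCE (§3 `rowSystem_not_geometric`): for every `C` and every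
`κ < 1` some instance of the row system — same constants `c, θ, m, U`, whatever their size — has `δ_j > Cκ^j`.  So the decay hypothesis
`FadingMemory` of node U2 (or some other input beyond the row split: e.g. a GEOMETRIC concentration of the AF weights at the pin, which
asymptotically free runs never have — their weight at infrared distance `n` is `≍ (bn)^{−3∕2}`) is exactly what the geometric SHAPE costs;
(E33g)'s stretched exponent `½` cannot be raised through the row system (any `exp(−A·j^p)`, `p > ½`, is eventually below the envelope).
Numerics (seat kit `g36/e34/num/`, not used here): the MAXIMAL solution of the row system with the weights of §2 (`c = 1, θ = ½, m·U = ½`)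
has `sup_K δ_j` attained at `K ≈ j + 2` with `−log δ_j ∕ j = 0.19, 0.19, 0.18` and `−log δ_j ∕ √j = 1.2, 1.7, 1.9` at `j = 40, 80, 120`
(AF profile `n^{−3∕2}`: `0.19, 0.18, 0.16` and `1.2, 1.6, 1.8`); pin-supported weights give `θ^{j∕2}` (companion (E34c)).

WHAT IS PROVED ([folklore]; 0 `def`, 0 sorry): §1 `blockValue_antitone`, `blockProfile_rows`; §2 `sum_inv_succ_mul_succ`,
`afWeights_sum_le`; §3 `rowSystem_instance`, `rowSystem_not_geometric`; §4 `rowSystem_envelope`.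
-/

noncomputable section
open Finset Filter Topology

namespace Summit.QuantumFields.BalabanUV.Beta.EriceRemainderEnclosureHistoryRenewalExtremal

/-! ## §1 The block profile solves the row system -/

/-- The block values `V_t = cθ^{2L}∕R^t` for `t ≤ T`, `0` beyond, are nonnegative and non-increasing in `t` (`c, θ ≥ 0`, `R ≥ 1`). [folklore] -/
theorem blockValue_antitone {c θ R : ℝ} {L T : ℕ} (hc : 0 ≤ c) (hθ0 : 0 ≤ θ) (hR : 1 ≤ R) :
    (∀ t, 0 ≤ (if t ≤ T then c * θ ^ (2 * L) / R ^ t else 0)) ∧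
    ∀ a b, a ≤ b → (if b ≤ T then c * θ ^ (2 * L) / R ^ b else 0) ≤ (if a ≤ T then c * θ ^ (2 * L) / R ^ a else 0) := by
  have hnum : 0 ≤ c * θ ^ (2 * L) := mul_nonneg hc (pow_nonneg hθ0 _)
  have hR0 : 0 < R := lt_of_lt_of_le one_pos hR
  refine ⟨fun t => ?_, fun a b hab => ?_⟩
  · split_ifs
    · exact div_nonneg hnum (pow_nonneg hR0.le _)
    · exact le_rfl
  · by_cases hb : b ≤ T
    · have ha : a ≤ T := hab.trans hb
      rw [if_pos hb, if_pos ha]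
      exact div_le_div_of_nonneg_left hnum (pow_pos hR0 _) (pow_le_pow_right₀ hR hab)
    · rw [if_neg hb]
      split_ifs
      · exact div_nonneg hnum (pow_nonneg hR0.le _)
      · exact le_rfl

/-- **THE BLOCK PROFILE SOLVES THE ROW SYSTEM.**  Blocks of `L ≥ 1` scales, `δ_l = V_{⌊l∕L⌋}` with `V_t = cθ^{2L}∕R^t` (`t ≤ T`), `0`
(`t > T`); `c ≥ 0`, `0 ≤ θ < 1`, `R ≥ 1`, `m ≥ 0`, weights `w ≥ 0` with the feedback strength `R·m·w_l ≥ 1` on the blocks `t ≥ 1`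
(`L ≤ l < (T+1)L`).  THEN: `δ ≥ 0`, non-increasing, `δ_{(T+1)L} = 0`, `δ_{TL} = cθ^{2L}∕R^T`, and every row `l < (T+1)L` satisfies the
split for EVERY window `s` (deletion term `2(cθ^s∕(1−θ))`) and the full-window row — the hypothesis shapes `hrec` of (E33b)
`stretched_of_split` ∕ `bound_of_split` and (E33g) `sqrt_supersolution` verbatim. [folklore] -/
theorem blockProfile_rows {c θ R m : ℝ} {L T : ℕ} {w δ : ℕ → ℝ}
    (hc : 0 ≤ c) (hθ0 : 0 ≤ θ) (hθ1 : θ < 1) (hR : 1 ≤ R) (hL : 1 ≤ L) (hm : 0 ≤ m) (hw : ∀ l, 0 ≤ w l)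
    (hwR : ∀ l, L ≤ l → l < (T + 1) * L → 1 ≤ R * (m * w l))
    (hδ : ∀ l, δ l = if l / L ≤ T then c * θ ^ (2 * L) / R ^ (l / L) else 0) :
    (∀ l, 0 ≤ δ l) ∧ (∀ i j, i ≤ j → δ j ≤ δ i) ∧ δ ((T + 1) * L) = 0 ∧ δ (T * L) = c * θ ^ (2 * L) / R ^ T ∧
    (∀ l, l < (T + 1) * L → ∀ s : ℕ, ∀ B' : ℝ, (∀ i, l - s ≤ i → i ≤ l → δ i ≤ B') →
        δ l ≤ δ (l + 1) + c * θ ^ l + 2 * (c * θ ^ s / (1 - θ)) + m * w l * B') ∧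
    (∀ l, l < (T + 1) * L → ∀ B' : ℝ, (∀ i, i ≤ l → δ i ≤ B') → δ l ≤ δ (l + 1) + c * θ ^ l + m * w l * B') := by
  have hL0 : 0 < L := hL
  set V : ℕ → ℝ := fun t => if t ≤ T then c * θ ^ (2 * L) / R ^ t else 0 with hVdef
  have hδV : ∀ l, δ l = V (l / L) := fun l => by rw [hδ l]
  obtain ⟨hV0, hVanti⟩ := blockValue_antitone (L := L) (T := T) hc hθ0 hR
  have hθ1' : θ ≤ 1 := hθ1.le
  have hnum : 0 ≤ c * θ ^ (2 * L) := mul_nonneg hc (pow_nonneg hθ0 _)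
  have hR0 : 0 < R := lt_of_lt_of_le one_pos hR
  -- basic facts
  have hδ0 : ∀ l, 0 ≤ δ l := fun l => by rw [hδV]; exact hV0 _
  have hanti : ∀ i j, i ≤ j → δ j ≤ δ i := fun i j hij => by
    rw [hδV, hδV]; exact hVanti _ _ (Nat.div_le_div_right hij)
  have hVT : ∀ t, t ≤ T → V t = c * θ ^ (2 * L) / R ^ t := fun t ht => by simp [hVdef, ht]
  have hVle0 : ∀ t, V t ≤ V 0 := fun t => hVanti 0 t (Nat.zero_le _)
  have hV00 : V 0 = c * θ ^ (2 * L) := by rw [hVT 0 (Nat.zero_le _), pow_zero, div_one]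
  -- the drop at row `l` is at most `V ⌊l∕L⌋`
  have hdrop : ∀ l, δ l - δ (l + 1) ≤ V (l / L) := fun l => by
    rw [hδV, hδV]; linarith [hV0 ((l + 1) / L)]
  -- the previous block's value is `R` times the current one
  have hVprev : ∀ t, 1 ≤ t → t ≤ T → V (t - 1) = R * V t := fun t ht htT => by
    rw [hVT t htT, hVT (t - 1) (by omega)]
    obtain ⟨u, rfl⟩ : ∃ u, t = u + 1 := ⟨t - 1, by omega⟩
    rw [Nat.add_sub_cancel, pow_succ]
    field_simp
  refine ⟨hδ0, hanti, ?_, ?_, ?_, ?_⟩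
  · rw [hδV, Nat.mul_div_cancel _ hL0]; simp [hVdef]
  · rw [hδV, Nat.mul_div_cancel _ hL0, hVT T le_rfl]
  · -- the split rows, every window
    intro l hl s B' hB'
    have ht : l / L ≤ T := Nat.lt_succ_iff.mp ((Nat.div_lt_iff_lt_mul hL0).mpr hl)
    have hlt : l < (l / L + 1) * L := (Nat.div_lt_iff_lt_mul hL0).mp (Nat.lt_succ_self _)
    have hB'0 : δ l ≤ B' := hB' l (Nat.sub_le l s) le_rfl
    have hB'nn : 0 ≤ B' := (hδ0 l).trans hB'0
    have hfb : 0 ≤ m * w l * B' := mul_nonneg (mul_nonneg hm (hw l)) hB'nn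
    have hdel : 0 ≤ 2 * (c * θ ^ s / (1 - θ)) := by
      have : 0 < 1 - θ := by linarith
      positivity
    have hsrc : 0 ≤ c * θ ^ l := mul_nonneg hc (pow_nonneg hθ0 _)
    rcases Nat.eq_zero_or_pos (l / L) with ht0 | htpos
    · -- block 0: the source pays
      have hlL : l < 2 * L := by rw [ht0] at hlt; omega
      have h1 : V (l / L) ≤ c * θ ^ l := by
        rw [ht0, hV00]; exact mul_le_mul_of_nonneg_left (pow_le_pow_of_le_one hθ0 hθ1' hlL.le) hc
      linarith [hdrop l]
    · by_cases hA : l - s ≤ (l / L - 1) * L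
      · -- the window reaches the previous block: the feedback pays
        have hprev : δ ((l / L - 1) * L) = V (l / L - 1) := by rw [hδV, Nat.mul_div_cancel _ hL0]
        have hle : (l / L - 1) * L ≤ l := by
          have h1 : (l / L - 1) * L ≤ l / L * L := Nat.mul_le_mul_right _ (Nat.sub_le _ _)
          exact h1.trans ((Nat.le_div_iff_mul_le hL0).mp le_rfl)
        have hB'1 : V (l / L - 1) ≤ B' := by rw [← hprev]; exact hB' _ hA hle
        have h2 : V (l / L) ≤ m * w l * B' := by
          have h3 := hwR l ((Nat.le_div_iff_mul_le hL0).mp htpos |>.trans' (by simp)) hl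
          have h4 : V (l / L - 1) = R * V (l / L) := hVprev _ htpos ht
          calc V (l / L) = 1 * V (l / L) := (one_mul _).symm
            _ ≤ R * (m * w l) * V (l / L) := mul_le_mul_of_nonneg_right h3 (hV0 _)
            _ = m * w l * V (l / L - 1) := by rw [h4]; ring
            _ ≤ m * w l * B' := mul_le_mul_of_nonneg_left hB'1 (mul_nonneg hm (hw l))
        linarith [hdrop l]
      · -- a short window: the deletion term pays
        have hs : s ≤ 2 * L := by
          have h1 : l / L + 1 = (l / L - 1) + 2 := by omega
          rw [h1, add_mul] at hlt
          omega
        have h1θ : 0 < 1 - θ := by linarith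
        have h2 : V (l / L) ≤ 2 * (c * θ ^ s / (1 - θ)) := by
          have h3 : c * θ ^ (2 * L) ≤ c * θ ^ s := mul_le_mul_of_nonneg_left (pow_le_pow_of_le_one hθ0 hθ1' hs) hc
          have h4 : c * θ ^ s ≤ c * θ ^ s / (1 - θ) := by
            rw [le_div_iff₀ h1θ]; nlinarith [mul_nonneg hc (pow_nonneg hθ0 s)]
          linarith [hVle0 (l / L), hV00, mul_nonneg hc (pow_nonneg hθ0 s)]
        linarith [hdrop l]
  · -- the full-window rows
    intro l hl B' hB'
    have ht : l / L ≤ T := Nat.lt_succ_iff.mp ((Nat.div_lt_iff_lt_mul hL0).mpr hl)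
    have hlt : l < (l / L + 1) * L := (Nat.div_lt_iff_lt_mul hL0).mp (Nat.lt_succ_self _)
    have hB'0 : δ 0 ≤ B' := hB' 0 (Nat.zero_le _)
    have hB'nn : 0 ≤ B' := (hδ0 0).trans hB'0
    have hfb : 0 ≤ m * w l * B' := mul_nonneg (mul_nonneg hm (hw l)) hB'nn
    have hsrc : 0 ≤ c * θ ^ l := mul_nonneg hc (pow_nonneg hθ0 _)
    rcases Nat.eq_zero_or_pos (l / L) with ht0 | htpos
    · have hlL : l < 2 * L := by rw [ht0] at hlt; omega
      have h1 : V (l / L) ≤ c * θ ^ l := by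
        rw [ht0, hV00]; exact mul_le_mul_of_nonneg_left (pow_le_pow_of_le_one hθ0 hθ1' hlL.le) hc
      linarith [hdrop l]
    · have hB'1 : V (l / L - 1) ≤ B' := by
        have : δ 0 = V 0 := by rw [hδV, Nat.zero_div]
        linarith [hVle0 (l / L - 1)]
      have h2 : V (l / L) ≤ m * w l * B' := by
        have h3 := hwR l ((Nat.le_div_iff_mul_le hL0).mp htpos |>.trans' (by simp)) hl
        have h4 : V (l / L - 1) = R * V (l / L) := hVprev _ htpos ht
        calc V (l / L) = 1 * V (l / L) := (one_mul _).symm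
          _ ≤ R * (m * w l) * V (l / L) := mul_le_mul_of_nonneg_right h3 (hV0 _)
          _ = m * w l * V (l / L - 1) := by rw [h4]; ring
          _ ≤ m * w l * B' := mul_le_mul_of_nonneg_left hB'1 (mul_nonneg hm (hw l))
      linarith [hdrop l]

/-! ## §2 The infrared-concentrated weights `U∕((K−l+1)(K−l+2))` -/

/-- Telescoping: `Σ_{n<N} 1∕((n+1)(n+2)) = 1 − 1∕(N+1)`. [folklore] -/
theorem sum_inv_succ_mul_succ (N : ℕ) :
    ∑ n ∈ range N, (1 : ℝ) / (((n : ℝ) + 1) * ((n : ℝ) + 2)) = 1 - 1 / ((N : ℝ) + 1) := by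
  induction N with
  | zero => simp
  | succ N ih =>
    rw [sum_range_succ, ih, Nat.cast_succ]
    have h1 : (N : ℝ) + 1 ≠ 0 := by positivity
    have h2 : (N : ℝ) + 2 ≠ 0 := by positivity
    have h3 : (N : ℝ) + 1 + 1 ≠ 0 := by positivity
    field_simp
    ring

/-- The weights `w_l = U∕((K−l+1)(K−l+2))` (ℕ-subtraction), `U ≥ 0`: nonnegative, `Σ_{l≤K} w_l ≤ U`, non-decreasing on `[0, K]` (larger
towards the infrared pin), and dominated by `U∕(K−l+1)²` (hence by the asymptotic-freedom profile `(K−l+1)^{−3∕2}`). [folklore] -/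
theorem afWeights_sum_le {U : ℝ} {K : ℕ} {w : ℕ → ℝ} (hU : 0 ≤ U)
    (hw : ∀ l, w l = U / ((((K - l : ℕ) : ℝ) + 1) * (((K - l : ℕ) : ℝ) + 2))) :
    (∀ l, 0 ≤ w l) ∧ (∑ l ∈ range (K + 1), w l ≤ U) ∧ (∀ i j, i ≤ j → j ≤ K → w i ≤ w j) ∧
    ∀ l, w l ≤ U / (((K - l : ℕ) : ℝ) + 1) ^ 2 := by
  have hpos : ∀ n : ℕ, 0 < ((n : ℝ) + 1) * ((n : ℝ) + 2) := fun n => by positivity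
  refine ⟨fun l => by rw [hw]; exact div_nonneg hU (hpos _).le, ?_, ?_, ?_⟩
  · have e1 : ∑ l ∈ range (K + 1), w l = U * ∑ n ∈ range (K + 1), (1 : ℝ) / (((n : ℝ) + 1) * ((n : ℝ) + 2)) := by
      rw [mul_sum, ← sum_range_reflect]
      refine sum_congr rfl fun l hl => ?_
      have hl' : l ≤ K := Nat.lt_succ_iff.mp (mem_range.mp hl)
      rw [hw, show K + 1 - 1 - l = K - l from by omega, show K - (K - l) = l from by omega]
      ring
    rw [e1, sum_inv_succ_mul_succ]
    have : 0 ≤ 1 / ((((K + 1 : ℕ) : ℝ)) + 1) := by positivity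
    nlinarith
  · intro i j hij hjK
    rw [hw, hw]
    have hle : ((K - j : ℕ) : ℝ) ≤ ((K - i : ℕ) : ℝ) := by exact_mod_cast (by omega : K - j ≤ K - i)
    have h0 : (0 : ℝ) ≤ ((K - j : ℕ) : ℝ) := Nat.cast_nonneg _
    exact div_le_div_of_nonneg_left hU (hpos _) (by nlinarith)
  · intro l
    rw [hw]
    have h0 : (0 : ℝ) ≤ ((K - l : ℕ) : ℝ) := Nat.cast_nonneg _
    exact div_le_div_of_nonneg_left hU (by positivity) (by nlinarith)

/-! ## §3 Instances of the row system with no geometric rate -/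

/-- **AN INSTANCE OF THE ROW SYSTEM AT EVERY SIZE.**  For `c ≥ 0`, `0 ≤ θ < 1`, `m, U ≥ 0`, `L ≥ 2` and any `R ≥ 1` with
`4L⁴ ≤ R·m·U`: with `K = L² + L`, the weights `w_l = U∕((K−l+1)(K−l+2))` and the block profile `δ` (blocks of `L`, `T = L`), ALL the
data ∕ hypotheses of (E33b)∕(E33g)'s abstract lemmas hold — `w ≥ 0`, `Σ_{l≤K} w_l ≤ U`, `w` non-decreasing towards the pin and
`≤ U∕(K−l+1)²`, `δ ≥ 0` non-increasing, `δ_K = 0`, every row `l < K` splits for EVERY window `s` with deletion term `2(cθ^s∕(1−θ))` and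
satisfies the full-window row — while `δ_{L²} = cθ^{2L}∕R^L`. [folklore] -/
theorem rowSystem_instance {c θ m U R : ℝ} {L : ℕ} (hc : 0 ≤ c) (hθ0 : 0 ≤ θ) (hθ1 : θ < 1) (hm : 0 ≤ m) (hU : 0 ≤ U)
    (hR1 : 1 ≤ R) (hL : 2 ≤ L) (hR : 4 * (L : ℝ) ^ 4 ≤ R * (m * U)) :
    ∃ (K : ℕ) (w δ : ℕ → ℝ), K = L ^ 2 + L ∧ (∀ l, 0 ≤ w l) ∧ (∑ l ∈ range (K + 1), w l ≤ U) ∧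
      (∀ i j, i ≤ j → j ≤ K → w i ≤ w j) ∧ (∀ l, w l ≤ U / (((K - l : ℕ) : ℝ) + 1) ^ 2) ∧
      (∀ l, 0 ≤ δ l) ∧ (∀ i j, i ≤ j → δ j ≤ δ i) ∧ δ K = 0 ∧
      (∀ l, l < K → ∀ s : ℕ, ∀ B' : ℝ, (∀ i, l - s ≤ i → i ≤ l → δ i ≤ B') →
        δ l ≤ δ (l + 1) + c * θ ^ l + 2 * (c * θ ^ s / (1 - θ)) + m * w l * B') ∧
      (∀ l, l < K → ∀ B' : ℝ, (∀ i, i ≤ l → δ i ≤ B') → δ l ≤ δ (l + 1) + c * θ ^ l + m * w l * B') ∧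
      δ (L ^ 2) = c * θ ^ (2 * L) / R ^ L := by
  set K := L ^ 2 + L with hK
  set w : ℕ → ℝ := fun l => U / ((((K - l : ℕ) : ℝ) + 1) * (((K - l : ℕ) : ℝ) + 2)) with hwdef
  set δ : ℕ → ℝ := fun l => if l / L ≤ L then c * θ ^ (2 * L) / R ^ (l / L) else 0 with hδdef
  obtain ⟨hw0, hwsum, hwmono, hwdom⟩ := afWeights_sum_le (K := K) (w := w) hU (fun l => rfl)
  have hKL : (L + 1) * L = K := by rw [hK]; ring
  have hL1 : 1 ≤ L := by omega
  have hR0 : 0 < R := lt_of_lt_of_le one_pos hR1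
  -- feedback strength on blocks ≥ 1: `(K−l+1)(K−l+2) ≤ (L²+1)(L²+2) ≤ 4L⁴`
  have hwR : ∀ l, L ≤ l → l < (L + 1) * L → 1 ≤ R * (m * w l) := by
    intro l hl1 hl2
    have hn : K - l ≤ L ^ 2 := by rw [hKL] at hl2; rw [hK]; omega
    have hnr : ((K - l : ℕ) : ℝ) ≤ (L : ℝ) ^ 2 := by exact_mod_cast hn
    have hn0 : (0 : ℝ) ≤ ((K - l : ℕ) : ℝ) := Nat.cast_nonneg _
    have hL2 : (2 : ℝ) ≤ L := by exact_mod_cast hL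
    have hden : (((K - l : ℕ) : ℝ) + 1) * (((K - l : ℕ) : ℝ) + 2) ≤ 4 * (L : ℝ) ^ 4 := by
      have h1 : (((K - l : ℕ) : ℝ) + 1) * (((K - l : ℕ) : ℝ) + 2) ≤ ((L : ℝ) ^ 2 + 1) * ((L : ℝ) ^ 2 + 2) := by nlinarith
      have h2 : (4 : ℝ) ≤ (L : ℝ) ^ 2 := by nlinarith
      nlinarith
    have hdpos : 0 < (((K - l : ℕ) : ℝ) + 1) * (((K - l : ℕ) : ℝ) + 2) := by positivity
    have hmU : 4 * (L : ℝ) ^ 4 / R ≤ m * U := by rw [div_le_iff₀ hR0]; linarith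
    have h3 : m * w l = m * U / ((((K - l : ℕ) : ℝ) + 1) * (((K - l : ℕ) : ℝ) + 2)) := by
      simp only [hwdef]; ring
    rw [h3, mul_div_assoc', one_le_div hdpos]
    calc (((K - l : ℕ) : ℝ) + 1) * (((K - l : ℕ) : ℝ) + 2) ≤ 4 * (L : ℝ) ^ 4 := hden
      _ = R * (4 * (L : ℝ) ^ 4 / R) := by field_simp
      _ ≤ R * (m * U) := mul_le_mul_of_nonneg_left hmU hR0.le
  obtain ⟨hδ0, hanti, hpin, hval, hrows, hfull⟩ :=
    blockProfile_rows (T := L) (w := w) (δ := δ) hc hθ0 hθ1 hR1 hL1 hm hw0 hwR (fun l => rfl)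
  rw [hKL] at hpin hrows hfull
  refine ⟨K, w, δ, rfl, hw0, hwsum, hwmono, hwdom, hδ0, hanti, hpin, hrows, hfull, ?_⟩
  rw [sq, hval]

/-- **NO GEOMETRIC RATE FOLLOWS FROM THE ROW SYSTEM.**  For ALL constants `c > 0`, `0 < θ < 1`, `m > 0`, `U > 0` (however small the
feedback `m·U`) and every `C > 0`, `0 < κ < 1` there are `K`, weights `w` (`≥ 0`, `Σ_{l≤K} w_l ≤ U`, non-decreasing towards the pin,
`≤ U∕(K−l+1)²`) and a solution `δ` of the row system (`δ ≥ 0` non-increasing, `δ_K = 0`, every row split for every window with deletion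
term `2(cθ^s∕(1−θ))`, every full-window row) with `δ_j > C·κ^j` at some `j ≤ K`.  Hence the conclusion shape of (E33g)
`disc_le_sqrt_uniform` cannot be improved to node U2's geometric `InjectedRate C 0 κ` shape by any argument factoring through (E33a)
`disc_row_split` ∕ `disc_row_full` + the pin + the AF weight sum + near-monotonicity. [folklore] -/
theorem rowSystem_not_geometric {c θ m U C κ : ℝ} (hc : 0 < c) (hθ0 : 0 < θ) (hθ1 : θ < 1) (hm : 0 < m) (hU : 0 < U)
    (hC : 0 < C) (hκ0 : 0 < κ) (hκ1 : κ < 1) :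
    ∃ (K : ℕ) (w δ : ℕ → ℝ) (j : ℕ), (∀ l, 0 ≤ w l) ∧ (∑ l ∈ range (K + 1), w l ≤ U) ∧
      (∀ i j, i ≤ j → j ≤ K → w i ≤ w j) ∧ (∀ l, w l ≤ U / (((K - l : ℕ) : ℝ) + 1) ^ 2) ∧
      (∀ l, 0 ≤ δ l) ∧ (∀ i j, i ≤ j → δ j ≤ δ i) ∧ δ K = 0 ∧
      (∀ l, l < K → ∀ s : ℕ, ∀ B' : ℝ, (∀ i, l - s ≤ i → i ≤ l → δ i ≤ B') →
        δ l ≤ δ (l + 1) + c * θ ^ l + 2 * (c * θ ^ s / (1 - θ)) + m * w l * B') ∧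
      (∀ l, l < K → ∀ B' : ℝ, (∀ i, i ≤ l → δ i ≤ B') → δ l ≤ δ (l + 1) + c * θ ^ l + m * w l * B') ∧
      j ≤ K ∧ C * κ ^ j < δ j := by
  -- the size `L`: `Y_L := κ^L·(1 + 4L⁴∕(mU))∕θ² → 0`, take `Y_L < ε := min (1∕2) (c∕(2C))` and `L ≥ 2`
  have hmU : 0 < m * U := mul_pos hm hU
  have hκabs : |κ| < 1 := by rw [abs_of_pos hκ0]; exact hκ1
  have hY : Tendsto (fun L : ℕ => κ ^ L * (1 + 4 * (L : ℝ) ^ 4 / (m * U)) / θ ^ 2) atTop (𝓝 0) := by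
    have h1 : Tendsto (fun L : ℕ => κ ^ L) atTop (𝓝 0) := tendsto_pow_atTop_nhds_zero_of_lt_one hκ0.le hκ1
    have h2 : Tendsto (fun L : ℕ => (L : ℝ) ^ 4 * κ ^ L) atTop (𝓝 0) := tendsto_pow_const_mul_const_pow_of_abs_lt_one 4 hκabs
    have h3 : Tendsto (fun L : ℕ => (κ ^ L + 4 / (m * U) * ((L : ℝ) ^ 4 * κ ^ L)) / θ ^ 2) atTop (𝓝 0) := by
      have := (h1.add (h2.const_mul (4 / (m * U)))).div_const (θ ^ 2)
      simpa using this
    refine h3.congr fun L => ?_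
    field_simp
  set ε : ℝ := min (1 / 2) (c / (2 * C)) with hεdef
  have hε0 : 0 < ε := lt_min (by norm_num) (by positivity)
  obtain ⟨L, hL2, hLε⟩ : ∃ L : ℕ, 2 ≤ L ∧ κ ^ L * (1 + 4 * (L : ℝ) ^ 4 / (m * U)) / θ ^ 2 < ε := by
    have hev := (eventually_ge_atTop 2).and ((tendsto_order.1 hY).2 ε hε0)
    exact hev.exists
  -- the instance at size `L` with `R := max 1 (4L⁴∕(mU))`
  set R : ℝ := max 1 (4 * (L : ℝ) ^ 4 / (m * U)) with hRdef
  have hR1 : 1 ≤ R := le_max_left _ _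
  have hR0 : 0 < R := lt_of_lt_of_le one_pos hR1
  have hR : 4 * (L : ℝ) ^ 4 ≤ R * (m * U) := by
    have : 4 * (L : ℝ) ^ 4 / (m * U) ≤ R := le_max_right _ _
    rwa [div_le_iff₀ hmU] at this
  obtain ⟨K, w, δ, hK, hw0, hwsum, hwmono, hwdom, hδ0, hanti, hpin, hrows, hfull, hval⟩ :=
    rowSystem_instance hc.le hθ0.le hθ1 hm.le hU.le hR1 hL2 hR
  refine ⟨K, w, δ, L ^ 2, hw0, hwsum, hwmono, hwdom, hδ0, hanti, hpin, hrows, hfull, by rw [hK]; omega, ?_⟩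
  rw [hval]
  -- `Y := κ^L·R∕θ²` has `Y ≤ Y_L < ε`, so `Y^L ≤ Y < c∕C`, i.e. `C(κ^L)^L < c(θ²∕R)^L`
  have hθ2 : 0 < θ ^ 2 := pow_pos hθ0 2
  set Y : ℝ := κ ^ L * R / θ ^ 2 with hYdef
  have hY0 : 0 ≤ Y := div_nonneg (mul_nonneg (pow_nonneg hκ0.le _) hR0.le) hθ2.le
  have hYle : Y ≤ κ ^ L * (1 + 4 * (L : ℝ) ^ 4 / (m * U)) / θ ^ 2 := by
    have h4L : 0 ≤ 4 * (L : ℝ) ^ 4 / (m * U) := by positivity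
    have hRle : R ≤ 1 + 4 * (L : ℝ) ^ 4 / (m * U) := max_le (by linarith) (by linarith)
    exact div_le_div_of_nonneg_right (mul_le_mul_of_nonneg_left hRle (pow_nonneg hκ0.le _)) hθ2.le
  have hYε : Y < ε := lt_of_le_of_lt hYle hLε
  have hY1 : Y ≤ 1 := by linarith [min_le_left (1 / 2 : ℝ) (c / (2 * C))]
  have hYc : Y < c / C := by
    have : c / (2 * C) < c / C := by
      rw [div_lt_div_iff₀ (by positivity) hC]; nlinarith
    linarith [min_le_right (1 / 2 : ℝ) (c / (2 * C))]
  have hL1 : 1 ≤ L := by omega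
  have hYL : Y ^ L < c / C := lt_of_le_of_lt (by simpa using pow_le_pow_of_le_one hY0 hY1 hL1) hYc
  have e1 : Y ^ L = (κ ^ L) ^ L / (θ ^ 2 / R) ^ L := by
    rw [hYdef, ← div_pow]; congr 1; field_simp
  have hq0 : 0 < (θ ^ 2 / R) ^ L := pow_pos (div_pos hθ2 hR0) L
  rw [e1, div_lt_div_iff₀ hq0 hC] at hYL
  calc C * κ ^ L ^ 2 = (κ ^ L) ^ L * C := by rw [sq, pow_mul]; ring
    _ < c * (θ ^ 2 / R) ^ L := hYL
    _ = c * θ ^ (2 * L) / R ^ L := by rw [div_pow, pow_mul]; ring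

/-! ## §4 The envelope: the instances decay no faster than `exp(−B·√j·log j)` -/

/-- **THE ENVELOPE.**  For `c > 0`, `0 < θ < 1`, `m·U > 0` put `B := 4 + (log 4 + |log (m·U)| + 2|log θ|)∕log 2`.  For every `L ≥ 2` the
instance of `rowSystem_instance` with `R = max 1 (4L⁴∕(mU))` has, at `j = L²` (so `L = √j`, `L·log L = ½√j·log j`),
`δ_{L²} = cθ^{2L}∕R^L ≥ c·exp(−B·L·log L)`: along `j = L²` the row system admits solutions above `c·exp(−(B∕2)·√j·log j)` — eventually above
every `C·exp(−A·j^p)` with `p > ½`, in particular above every geometric `Cκ^j`; compare (E33g)'s upper bound `L′·ρ^⌊√j⌋`. [folklore] -/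
theorem rowSystem_envelope {c θ m U : ℝ} {L : ℕ} (hc : 0 < c) (hθ0 : 0 < θ) (hθ1 : θ < 1) (hmU : 0 < m * U) (hL : 2 ≤ L) :
    c * Real.exp (-(4 + (Real.log 4 + |Real.log (m * U)| + 2 * |Real.log θ|) / Real.log 2) * L * Real.log L)
      ≤ c * θ ^ (2 * L) / (max 1 (4 * (L : ℝ) ^ 4 / (m * U))) ^ L := by
  set R : ℝ := max 1 (4 * (L : ℝ) ^ 4 / (m * U)) with hRdef
  have hR1 : 1 ≤ R := le_max_left _ _
  have hR0 : 0 < R := lt_of_lt_of_le one_pos hR1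
  have hL2 : (2 : ℝ) ≤ L := by exact_mod_cast hL
  have hLpos : (0 : ℝ) < L := by linarith
  have hlog2 : 0 < Real.log 2 := Real.log_pos (by norm_num)
  have hlogL : Real.log 2 ≤ Real.log L := Real.log_le_log (by norm_num) hL2
  have hlogL0 : 0 < Real.log L := lt_of_lt_of_le hlog2 hlogL
  -- `log R ≤ log 4 + 4 log L + |log (mU)|`
  have hlogR : Real.log R ≤ Real.log 4 + 4 * Real.log L + |Real.log (m * U)| := by
    have hL4 : (1 : ℝ) ≤ 4 * (L : ℝ) ^ 4 := by
      have : (1 : ℝ) ≤ (L : ℝ) ^ 4 := one_le_pow₀ (by linarith)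
      linarith
    rcases le_or_gt (4 * (L : ℝ) ^ 4 / (m * U)) 1 with h | h
    · have : R = 1 := by rw [hRdef, max_eq_left h]
      rw [this, Real.log_one]
      have : 0 ≤ Real.log 4 := Real.log_nonneg (by norm_num)
      positivity
    · have hReq : R = 4 * (L : ℝ) ^ 4 / (m * U) := by rw [hRdef, max_eq_right h.le]
      rw [hReq, Real.log_div (by positivity) hmU.ne', Real.log_mul (by norm_num) (by positivity), Real.log_pow]
      push_cast
      linarith [neg_abs_le (Real.log (m * U))]
  -- the exponent comparison
  have hmain : -(4 + (Real.log 4 + |Real.log (m * U)| + 2 * |Real.log θ|) / Real.log 2) * L * Real.log L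
      ≤ (2 * L) * Real.log θ - L * Real.log R := by
    have hθabs : -|Real.log θ| ≤ Real.log θ := neg_abs_le _
    have hA0 : 0 ≤ Real.log 4 + |Real.log (m * U)| + 2 * |Real.log θ| := by
      have : 0 ≤ Real.log 4 := Real.log_nonneg (by norm_num); positivity
    -- `A ≤ (A ∕ log 2)·log L`
    have h1 : Real.log 4 + |Real.log (m * U)| + 2 * |Real.log θ|
        ≤ (Real.log 4 + |Real.log (m * U)| + 2 * |Real.log θ|) / Real.log 2 * Real.log L := by
      rw [div_mul_eq_mul_div, le_div_iff₀ hlog2]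
      exact mul_le_mul_of_nonneg_left hlogL hA0
    have h2 : L * Real.log R ≤ L * (Real.log 4 + 4 * Real.log L + |Real.log (m * U)|) :=
      mul_le_mul_of_nonneg_left hlogR hLpos.le
    have h3 : (2 * L) * (-|Real.log θ|) ≤ (2 * L) * Real.log θ := mul_le_mul_of_nonneg_left hθabs (by positivity)
    have h4 : (L : ℝ) * (Real.log 4 + |Real.log (m * U)| + 2 * |Real.log θ|)
        ≤ L * ((Real.log 4 + |Real.log (m * U)| + 2 * |Real.log θ|) / Real.log 2 * Real.log L) :=
      mul_le_mul_of_nonneg_left h1 hLpos.le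
    nlinarith [h2, h3, h4, mul_nonneg hLpos.le hlogL0.le]
  have e1 : Real.exp ((2 * L) * Real.log θ) = θ ^ (2 * L) := by
    rw [← Real.exp_log (pow_pos hθ0 (2 * L)), Real.log_pow]; push_cast; ring_nf
  have e2 : Real.exp ((L : ℝ) * Real.log R) = R ^ L := by
    rw [← Real.exp_log (pow_pos hR0 L), Real.log_pow]
  have hexp : Real.exp ((2 * L) * Real.log θ - L * Real.log R) = θ ^ (2 * L) / R ^ L := by
    rw [Real.exp_sub, e1, e2]
  rw [mul_div_assoc]
  refine mul_le_mul_of_nonneg_left ?_ hc.le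
  rw [← hexp]
  exact Real.exp_le_exp.mpr hmain

end Summit.QuantumFields.BalabanUV.Beta.EriceRemainderEnclosureHistoryRenewalExtremal

end
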